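import Summits.CriticalPhenomena.PercolationContinuityZ3.Theorems.PercNearOneGluingNoHeavyLowerTailSahiCTCN2Monotone
import HarnessLib

/-!
# `NoHeavyLowerTail` (crux stmt-CriticalPhenomena-4575), P3 lane: RELABELLING SYMMETRY of the c = 2 certificate polynomial `Ñ₂` and of flag
# configurations

Support file (seat `prim-l12-p3`, gen 20; `--supports stmt-CriticalPhenomena-4575`).  Standard axioms.  Memo
`run/shared/lean/prim/prim-l12/FROM-prim-l12-p3-g20-*.md`.

For a permutation `σ` of the ground type, relabelling both complexes by `σ` (`K ↦ K.map (σ.finsetCongr)`) renames `Ñ₂`: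
`N2gen (σK_X) (σK_Z) = rename σ (N2gen K_X K_Z)` (`N2gen_map`; from `gf_map` and the invariance of `Π, D, Θ, e₂`), coefficientwise
nonnegativity is invariant under `rename σ` (`cw_of_cw_rename`), and the flag configurations of `…SahiCTCN2Monotone` relabel covariantly
(`flagCx_map`, `privPairs_map`, `pairsIn_map`).  Consequence (`flagGood_of_map`, `flagValid_map`): the finite check of `Ñ₂ ∈ ℕ[r]` over flag
configurations may be restricted to one representative per relabelling orbit (used in `…SahiCTCN2Five`).  Nothing is asserted about the crux.
-/

namespace Summit.CriticalPhenomena.PercolationContinuityZ3.Theorems.SahiCTCForms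

open Finset MvPolynomial SahiCTCGenFun

variable {α : Type*} [DecidableEq α] [Fintype α] (σ : Equiv.Perm α)

/-! ### Relabelling generating functions -/

omit [Fintype α] in
/-- `1_{σS} = (1_S) ∘ σ⁻¹` as `mapDomain`. [this work] -/
theorem ind_map (S : Finset α) : ind (S.map σ.toEmbedding) = (ind S).mapDomain σ := by
  ext j
  obtain ⟨a, rfl⟩ := σ.surjective j
  rw [Finsupp.mapDomain_apply σ.injective, ind_apply, ind_apply]
  simp only [Finset.mem_map_equiv, Equiv.symm_apply_apply]

omit [DecidableEq α] [Fintype α] in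
/-- `σ.finsetCongr` acts by `Finset.map`. [folklore] -/
theorem finsetCongr_toEmbedding_apply (S : Finset α) : σ.finsetCongr.toEmbedding S = S.map σ.toEmbedding := rfl

omit [Fintype α] in
/-- **`GF(σF) = rename σ (GF F)`.** [this work] -/
theorem gf_map (F : Finset (Finset α)) : gf (F.map σ.finsetCongr.toEmbedding) = rename σ (gf F) := by
  unfold gf
  rw [map_sum, sum_map]
  refine sum_congr rfl fun S _ => ?_
  rw [finsetCongr_toEmbedding_apply, rename_monomial, ind_map]

omit [DecidableEq α] [Fintype α] in
/-- Undoing a relabelling. [folklore] -/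
theorem map_symm_map (T : Finset α) : (T.map σ.symm.toEmbedding).map σ.toEmbedding = T := by
  ext x; simp [Finset.mem_map_equiv]

omit [DecidableEq α] [Fintype α] in
/-- Undoing a relabelling. [folklore] -/
theorem map_map_symm (T : Finset α) : (T.map σ.toEmbedding).map σ.symm.toEmbedding = T := by
  ext x; simp [Finset.mem_map_equiv]

omit [DecidableEq α] in
/-- Transport of a filtered power set along `σ`. [this work] -/
theorem filter_univPowerset_eq_map {P Q : Finset α → Prop} [DecidablePred P] [DecidablePred Q] (h : ∀ S, P (S.map σ.toEmbedding) ↔ Q S) :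
    (univ.powerset.filter P : Finset (Finset α)) = (univ.powerset.filter Q).map σ.finsetCongr.toEmbedding := by
  ext T
  simp only [mem_filter, mem_powerset, subset_univ, true_and, mem_map, finsetCongr_toEmbedding_apply]
  constructor
  · intro hT
    exact ⟨T.map σ.symm.toEmbedding, (h _).1 (by rwa [map_symm_map]), map_symm_map σ T⟩
  · rintro ⟨S, hS, rfl⟩
    exact (h S).2 hS

omit [DecidableEq α] [Fintype α] in
/-- Membership of a relabelled set in a relabelled family. [folklore] -/
theorem map_mem_map_iff (K : Finset (Finset α)) (S : Finset α) : S.map σ.toEmbedding ∈ K.map σ.finsetCongr.toEmbedding ↔ S ∈ K := by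
  rw [Finset.mem_map_equiv, Equiv.finsetCongr_symm, Equiv.finsetCongr_apply, map_map_symm]

omit [DecidableEq α] in
/-- The size families are invariant. [this work] -/
theorem bySize_map (p : ℕ → Prop) [DecidablePred p] : (bySize p : Finset (Finset α)) = (bySize p).map σ.finsetCongr.toEmbedding := by
  unfold bySize
  exact filter_univPowerset_eq_map σ fun S => by rw [card_map]

omit [DecidableEq α] in
/-- The full power set is invariant. [this work] -/
theorem univPowerset_map : (univ.powerset : Finset (Finset α)) = (univ.powerset : Finset (Finset α)).map σ.finsetCongr.toEmbedding := by
  rw [Finset.powerset_univ, Finset.map_univ_equiv]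

section families
variable (KX KZ : Finset (Finset α))

/-- `h`, `t`, `h_Y`, `E_Y` relabel covariantly. [this work] -/
theorem faceFamilies_map :
    smallFaces (KX.map σ.finsetCongr.toEmbedding) = (smallFaces KX).map σ.finsetCongr.toEmbedding ∧
    bigFaces (KX.map σ.finsetCongr.toEmbedding) = (bigFaces KX).map σ.finsetCongr.toEmbedding ∧
    smallCommonFaces (KX.map σ.finsetCongr.toEmbedding) (KZ.map σ.finsetCongr.toEmbedding) =
      (smallCommonFaces KX KZ).map σ.finsetCongr.toEmbedding ∧
    commonEdges (KX.map σ.finsetCongr.toEmbedding) (KZ.map σ.finsetCongr.toEmbedding) =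
      (commonEdges KX KZ).map σ.finsetCongr.toEmbedding := by
  refine ⟨?_, ?_, ?_, ?_⟩
  · exact filter_univPowerset_eq_map σ fun S => by rw [card_map, map_mem_map_iff]
  · exact filter_univPowerset_eq_map σ fun S => by rw [card_map, map_mem_map_iff]
  · exact filter_univPowerset_eq_map σ fun S => by rw [card_map, map_mem_map_iff, map_mem_map_iff]
  · exact filter_univPowerset_eq_map σ fun S => by rw [card_map, map_mem_map_iff, map_mem_map_iff]

/-- **`Ñ₂` relabels by `rename`**: `N2gen (σK_X) (σK_Z) = rename σ (N2gen K_X K_Z)`. [this work] -/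
theorem N2gen_map : N2gen (KX.map σ.finsetCongr.toEmbedding) (KZ.map σ.finsetCongr.toEmbedding) = rename σ (N2gen KX KZ) := by
  obtain ⟨h1, h2, h3, h4⟩ := faceFamilies_map σ KX KZ
  obtain ⟨h5, h6, -, -⟩ := faceFamilies_map σ KZ KX
  have hPi : rename σ (PiP : MvPolynomial α ℤ) = PiP := by unfold PiP; rw [← gf_map, ← univPowerset_map]
  have hDd : rename σ (Dd : MvPolynomial α ℤ) = Dd := by unfold Dd; rw [← gf_map, ← bySize_map]
  have hTh : rename σ (Th : MvPolynomial α ℤ) = Th := by unfold Th; rw [← gf_map, ← bySize_map]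
  have he2 : rename σ (ee 2 : MvPolynomial α ℤ) = ee 2 := by unfold ee; rw [← gf_map, ← bySize_map]
  unfold N2gen
  simp only [map_add, map_sub, map_mul, hPi, hDd, hTh, he2, ← gf_map]
  rw [h1, h2, h3, h4, h5, h6]

end families

omit [DecidableEq α] [Fintype α] in
/-- Coefficientwise nonnegativity descends along `rename σ`. [this work] -/
theorem cw_of_cw_rename {P : MvPolynomial α ℤ} (h : ∀ n, 0 ≤ (rename σ P).coeff n) (n : α →₀ ℕ) : 0 ≤ P.coeff n := by
  rw [← coeff_rename_mapDomain σ σ.injective P n]; exact h _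

/-! ### Relabelling flag configurations -/

/-- Flag complexes relabel covariantly. [this work] -/
theorem flagCx_map (L : Finset α) (E : Finset (Finset α)) :
    flagCx (L.map σ.toEmbedding) (E.map σ.finsetCongr.toEmbedding) = (flagCx L E).map σ.finsetCongr.toEmbedding := by
  unfold flagCx
  refine filter_univPowerset_eq_map σ fun S => ?_
  rw [map_subset_map]
  refine and_congr Iff.rfl ⟨fun h e he h2 => ?_, fun h e he h2 => ?_⟩
  · rw [mem_powerset] at he
    have := h (e.map σ.toEmbedding) (mem_powerset.2 (map_subset_map.2 he)) (by rw [card_map]; exact h2)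
    rwa [map_mem_map_iff] at this
  · rw [mem_powerset] at he
    have he' : e.map σ.symm.toEmbedding ⊆ S := by
      have := (map_subset_map (f := σ.symm.toEmbedding)).2 he; rwa [map_map_symm] at this
    have := h (e.map σ.symm.toEmbedding) (mem_powerset.2 he') (by rw [card_map]; exact h2)
    rw [← map_mem_map_iff σ, map_symm_map] at this; exact this

/-- Private pairs relabel covariantly. [this work] -/
theorem privPairs_map (L L' : Finset α) :
    privPairs (L.map σ.toEmbedding) (L'.map σ.toEmbedding) = (privPairs L L').map σ.finsetCongr.toEmbedding := by
  unfold privPairs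
  exact filter_univPowerset_eq_map σ fun S => by rw [card_map, map_subset_map, map_subset_map]

/-- `pairsIn` relabels covariantly. [this work] -/
theorem pairsIn_map (B : Finset α) : pairsIn (B.map σ.toEmbedding) = (pairsIn B).map σ.finsetCongr.toEmbedding := by
  unfold pairsIn
  exact filter_univPowerset_eq_map σ fun S => by rw [card_map, map_subset_map]

/-- **Validity of a flag configuration is invariant under relabelling.** [this work] -/
theorem flagValid_map {LX LZ : Finset α} {A B : Finset (Finset α)} (h1 : LX ∪ LZ = univ) (h2 : A ⊆ pairsIn (LX ∩ LZ))
    (h3 : B ⊆ pairsIn (LX ∩ LZ)) (h4 : pairsIn (LX ∩ LZ) ⊆ A ∪ B) :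
    LX.map σ.toEmbedding ∪ LZ.map σ.toEmbedding = univ ∧
    A.map σ.finsetCongr.toEmbedding ⊆ pairsIn (LX.map σ.toEmbedding ∩ LZ.map σ.toEmbedding) ∧
    B.map σ.finsetCongr.toEmbedding ⊆ pairsIn (LX.map σ.toEmbedding ∩ LZ.map σ.toEmbedding) ∧
    pairsIn (LX.map σ.toEmbedding ∩ LZ.map σ.toEmbedding) ⊆ A.map σ.finsetCongr.toEmbedding ∪ B.map σ.finsetCongr.toEmbedding := by
  rw [← map_union, h1, map_univ_equiv, ← map_inter, pairsIn_map, ← map_union]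
  exact ⟨rfl, map_subset_map.2 h2, map_subset_map.2 h3, map_subset_map.2 h4⟩

/-- **Nonnegativity of `Ñ₂` on a flag configuration descends from its relabelling.** [this work] -/
theorem flagGood_of_map {LX LZ : Finset α} {A B : Finset (Finset α)}
    (h : ∀ n, 0 ≤ (N2gen (flagCx (LX.map σ.toEmbedding) (privPairs (LX.map σ.toEmbedding) (LZ.map σ.toEmbedding) ∪ A.map σ.finsetCongr.toEmbedding))
      (flagCx (LZ.map σ.toEmbedding) (privPairs (LZ.map σ.toEmbedding) (LX.map σ.toEmbedding) ∪ B.map σ.finsetCongr.toEmbedding))).coeff n)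
    (n : α →₀ ℕ) : 0 ≤ (N2gen (flagCx LX (privPairs LX LZ ∪ A)) (flagCx LZ (privPairs LZ LX ∪ B))).coeff n := by
  rw [privPairs_map, privPairs_map, ← map_union, ← map_union, flagCx_map, flagCx_map, N2gen_map] at h
  exact cw_of_cw_rename σ h n

/-- **Nonnegativity of `Ñ₂` on a flag configuration is symmetric under the swap `X ↔ Z`.** [this work] -/
theorem flagGood_swap {LX LZ : Finset α} {A B : Finset (Finset α)}
    (h : ∀ n, 0 ≤ (N2gen (flagCx LZ (privPairs LZ LX ∪ B)) (flagCx LX (privPairs LX LZ ∪ A))).coeff n) (n : α →₀ ℕ) :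
    0 ≤ (N2gen (flagCx LX (privPairs LX LZ ∪ A)) (flagCx LZ (privPairs LZ LX ∪ B))).coeff n := by
  rw [N2gen_comm]; exact h n

end Summit.CriticalPhenomena.PercolationContinuityZ3.Theorems.SahiCTCForms
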